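import Literature.NumberTheory.Rogawski1990.RankOneEulerPoincareNonsplitOfRamified   -- ★ p843527 B-p14 (g32): `rankOneEulerPoincareNonsplit_of_ramified (hram) : RankOneEulerPoincareNonsplit`
import HarnessLib

/-!
# The RAMIFIED RESIDUE of the rank-one Euler–Poincaré letter (R2) at a non-split place, NAMED (Kottwitz 1988 §2 Thm. 2; Rogawski 1990 §12.6)

Topic `NumberTheory/Rogawski1990`; namespace `Literature.NumberTheory.Rogawski1990`.  ONE definition (a `Prop`, the `hram` binder of ★ `rankOneEulerPoincareNonsplit_of_ramified`
VERBATIM); no theorem, no instance, no notation, no `sorry`.  Cell `pub/hodgecm-mathlib`, F0∕P3a line «N6nsGerm» (pen F0P2-p02 (g9)), (R2)-EP road (EP pen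
B-p04∕B-p14, (R2-ram) A-p06): the letter ★ `RankOneEulerPoincareNonsplit` (p841621, books row (R2)) — «at every non-split finite place of a CM field, the rank-one
quasi-split unitary group `U(Φ₂)(L⁺_v)` carries an Euler–Poincaré function: a locally constant compactly supported `f` whose canonical orbital integrals are `1` on the
regular ELLIPTIC classes and `0` on the regular non-elliptic ones» — is PROVED IN-HOUSE at every UNRAMIFIED place (★ p843527 over ★ p843494∕p843462: Kottwitz's count on the
tree of `U(1,1)`), so that the letter ⟸ its own body AT THE RAMIFIED non-split places.  This file NAMES that residue, **`RankOneEulerPoincareNonsplitRamified`**, so that the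
line «N6nsGerm» can carry it as ONE registered stub (`stub_N6nsR2ram`) and close `stub_N6nsR2EP` BY NAME (`rankOneEulerPoincareNonsplit_of_ramified stub_N6nsR2ram`, the def unfolding by delta), and the
books can re-point row (R2) to {unramified: PROVED in-house; ramified: NAMED residue — its tame part (`v ∤ 2`) is ★ p843526 modulo ONE binder (the non-elliptic relation at a
ramified place, A-p06 (N2)), its wild part (`v ∣ 2`) is print [Kottwitz1988 §2 Thm. 2 holds at every place]}.  PRINT TRUTH: Kottwitz's Theorem 2 (existence of
Euler–Poincaré functions with the stated orbital integrals) is place-independent; the residue is the same statement restricted to ramified `v`.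
HONEST LABEL: HC_CM is proved only modulo the printed citations until rung 0 closes; this file proves nothing about the residue — it names it.
-/

open scoped ValuativeRel Matrix MatrixGroups
open Matrix ValuativeRel NumberField IsDedekindDomain MulAction MeasureTheory Measure

namespace Literature.NumberTheory.Rogawski1990

open Literature.NumberTheory.Automorphic Literature.NumberTheory.Automorphic.UnitaryGroup Literature.NumberTheory.GaloisRepresentations

/-- **(R2-ram) THE RAMIFIED RESIDUE OF THE RANK-ONE EULER–POINCARÉ LETTER** — the body of ★ `RankOneEulerPoincareNonsplit` restricted to the non-split finite places `v` of
`L⁺` that are RAMIFIED in the CM field `L` (`¬ Algebra.IsUnramifiedIn (𝓞 L) v`): for the canonical orbital-measure family on `U(Φ₂)(L⁺_v)` there is a locally constant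
compactly supported `f` with orbital integral `1` on every regular elliptic class and `0` on every regular non-elliptic class (Kottwitz's Euler–Poincaré function; the
`hram` binder of ★ `rankOneEulerPoincareNonsplit_of_ramified` VERBATIM). [cite: Kottwitz1988, §2 Thm. 2] [cite: Rogawski1990, §12.6 p. 174] -/
def RankOneEulerPoincareNonsplitRamified : Prop :=
  ∀ (L : Type) [Field L] [NumberField L] [IsCMField L] (v : HeightOneSpectrum (𝓞 ↥(maximalRealSubfield L)))
  (w : UnitaryGroup.PlacesOver L v) (hw : IsCMField.complexConj L • w.1 = w.1),
  ¬ Algebra.IsUnramifiedIn (𝓞 L) v.asIdeal →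
  ∀ [MeasurableSpace ((UnitaryGroup.cmDatum L 2 (Matrix.of fun i j : Fin 2 => if i.val + j.val + 1 = 2 then (1 : L) else 0)).Local v)]
    [BorelSpace ((UnitaryGroup.cmDatum L 2 (Matrix.of fun i j : Fin 2 => if i.val + j.val + 1 = 2 then (1 : L) else 0)).Local v)]
    (ν : Measure ((UnitaryGroup.cmDatum L 2 (Matrix.of fun i j : Fin 2 => if i.val + j.val + 1 = 2 then (1 : L) else 0)).Local v))
    [ν.IsHaarMeasure] [ν.IsMulRightInvariant]
    [_iZ : ∀ γ : (UnitaryGroup.cmDatum L 2 (Matrix.of fun i j : Fin 2 => if i.val + j.val + 1 = 2 then (1 : L) else 0)).Local v,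
      MeasurableSpace (((UnitaryGroup.cmDatum L 2 (Matrix.of fun i j : Fin 2 => if i.val + j.val + 1 = 2 then (1 : L) else 0)).Local v) ⧸
        Subgroup.centralizer ({γ} : Set ((UnitaryGroup.cmDatum L 2 (Matrix.of fun i j : Fin 2 => if i.val + j.val + 1 = 2 then (1 : L) else 0)).Local v)))]
    [_bZ : ∀ γ : (UnitaryGroup.cmDatum L 2 (Matrix.of fun i j : Fin 2 => if i.val + j.val + 1 = 2 then (1 : L) else 0)).Local v,
      BorelSpace (((UnitaryGroup.cmDatum L 2 (Matrix.of fun i j : Fin 2 => if i.val + j.val + 1 = 2 then (1 : L) else 0)).Local v) ⧸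
        Subgroup.centralizer ({γ} : Set ((UnitaryGroup.cmDatum L 2 (Matrix.of fun i j : Fin 2 => if i.val + j.val + 1 = 2 then (1 : L) else 0)).Local v)))]
    (m : OrbitalMeasureFamily ((UnitaryGroup.cmDatum L 2 (Matrix.of fun i j : Fin 2 => if i.val + j.val + 1 = 2 then (1 : L) else 0)).Local v)),
    m.IsCanonical (fun γ => IsRegularElt (γ.val : GL (Fin 2) (UnitaryGroup.LocalRing L v))) ν →
    ∃ f : (UnitaryGroup.cmDatum L 2 (Matrix.of fun i j : Fin 2 => if i.val + j.val + 1 = 2 then (1 : L) else 0)).Local v → ℂ, IsLocSmooth f ∧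
      (∀ γ : (UnitaryGroup.cmDatum L 2 (Matrix.of fun i j : Fin 2 => if i.val + j.val + 1 = 2 then (1 : L) else 0)).Local v,
          IsRegularElt (γ.val : GL (Fin 2) (UnitaryGroup.LocalRing L v)) →
          CompactSpace (Subgroup.centralizer ({γ} : Set ((UnitaryGroup.cmDatum L 2 (Matrix.of fun i j : Fin 2 => if i.val + j.val + 1 = 2 then (1 : L) else 0)).Local v))) →
          classOrbitalIntegral m f (ConjClasses.mk γ) = 1) ∧
      (∀ γ : (UnitaryGroup.cmDatum L 2 (Matrix.of fun i j : Fin 2 => if i.val + j.val + 1 = 2 then (1 : L) else 0)).Local v,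
          IsRegularElt (γ.val : GL (Fin 2) (UnitaryGroup.LocalRing L v)) →
          ¬ CompactSpace (Subgroup.centralizer ({γ} : Set ((UnitaryGroup.cmDatum L 2 (Matrix.of fun i j : Fin 2 => if i.val + j.val + 1 = 2 then (1 : L) else 0)).Local v))) →
          classOrbitalIntegral m f (ConjClasses.mk γ) = 0)

end Literature.NumberTheory.Rogawski1990
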